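import Summits.HodgeConjecture.HodgeConjecture.Theorems.Ring2HypothesesDescentMotivatedAdjointStable
import HarnessLib

/-!
# Ring 2 hypotheses, descent face — André's positive involution preserves `C⁰_mot(X, X)_ℂ|_{Hᵃ}` in EVERY degree:
# the degrees above the middle, and the assembly (stability, all orientation families, André's semisimplicity proof)

research route conditional on HC_CM; not a corollary; Q11.4-sentence-2 already refuted in dim ≥ 3.
Cell `pub-hodge-ring2` (Hodge ladder STAGE 3), seat `ring2-b05` (binder row b05
`Ring2.Hypotheses.MotivatedImpliesAlgebraicAV`), gen 39, part 4 (parts 1–3: `…MotivatedWeilForm`, `…MotivatedPositivity`,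
`…MotivatedAdjointStable`). `HC_CM` (`Theses.RankFourFaces.CMAbelianHodge`) does not occur in this file; nothing here
proves a case of the Hodge conjecture; the row b05 stays OPEN.

Part 3 proved, in degrees `a ≤ n = dim X`, that the conjugate `Q_D`-adjoint `T'` of a motivated operator `T = [u]_*`
on `Hᵃ(X(ℂ); ℂ)` is again motivated (André 1996, Prop. 2.2 with Prop. 1.2: `C_mot(X, X)` is stable under the
transposition for `(x, y) ↦ ⟨x ∪ * y⟩`). This file does the degrees `a = a' + 2j ≥ n` (`a' + j = n`), where André's
`*_η : Hᵃ → Hᵃ'` is the INVERSE of the Lefschetz isomorphism `Lʲ`: the star of `Q_D` is still `*_η ∘ s` with `s` the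
sign operator (§1, `cform_eq_cTrace_lefschetzInvolution_signOp_of_ge`: `L^{n-i-t} ξ_P x = *_η (Lᵗ ξ_P x) = *_η (π_P x)`
because `Lᵗ = Lʲ ∘ L^{n-i-t}` and `*_η ∘ Lʲ = id` on `Hᵃ'`), so the same five-fold composite
`S = s ∘ *₂ ∘ [σ₊ conj u]_* ∘ *₁ ∘ s` is the adjoint (§2, `cform_adjoint_conj_mem_map_corrAction_of_ge`). §3 assembles:

* **`cform_adjoint_conj_mem_map_corrAction`** — ALL degrees `a`, complex orientation family (above `2n` the
  cohomology vanishes and `T' = 0`); **`cform_adjoint_conj_mem_map_corrAction_of_orientationFamily`** — every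
  orientation family `μ`: THE MOTIVATED OPERATOR ALGEBRA `R_a` IS A `'`-CLOSED SUBALGEBRA OF `End_ℂ Hᵃ(X(ℂ); ℂ)` for
  André's positive involution, in every degree;
* **`isSemisimpleRing_adjoin_motivatedOperators_of_positiveInvolution'`** — André's own proof of the semisimplicity
  of `R_a` («résulte aussi du théorème de l'indice de Hodge, cf. [Kl68] 3.11»), now in every degree: a positive
  involutive finite-dimensional algebra has no nilpotent ideal (`x` in the Jacobson radical ⇒ `x' x` nilpotent ⇒
  `Tr(x x') = 0` ⇒ `x = 0` by part 2).

No definition, no named fact, no sorry. References: Andre1996Motifs (Prop. 1.2 p. 11, §1.1 p. 10, Prop. 2.2 p. 16,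
Prop. 3.3 pp. 21–22), Kleiman1968AlgebraicCycles (§1.4 Prop. 1.4.4, §3 3.11), VoisinHodgeI2002 (§6.2.3 Cor. 6.26,
§6.3.2 (6.13), §7.1.2), Jannsen1992 (Lemma 1–2).
-/

noncomputable section

-- every declaration of this problem lives in `Summit.HodgeConjecture.HodgeConjecture.…` (summit = sub-problem)
set_option linter.dupNamespace false

open CategoryTheory AlgebraicGeometry MonoidalCategory CartesianMonoidalCategory
open Literature.AlgebraicTopology.SingularHomology Literature.Geometry.Kaehler
open Literature.AlgebraicGeometry Literature.AlgebraicGeometry.Motives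
  Literature.AlgebraicGeometry.HodgeTheory
open Summit.HodgeConjecture.HodgeConjecture.Theorems.LefschetzStandardB (conjClass_corrAction
  hodgeRiemannPairing_primitivePart_eq)

namespace Summit.HodgeConjecture.HodgeConjecture.Theorems

variable {n : ℕ} {X : SchemeOver ℂ}

/-! ## §1 `Q_D(x, y) = τ(*_η (s x) ∪ y)` above the middle degree -/

/-- **`Q_D(x, y) = τ(*_η (s x) ∪ y)` on `Hᵃ(X(ℂ); ℂ)` for `a = a' + 2j ≥ n`, `a' + j = n`** (`*_η : Hᵃ → Hᵃ'` is now the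
inverse of the Lefschetz isomorphism `Lʲ : Hᵃ' → Hᵃ`, `s` the sign operator of the Lefschetz decomposition of `Hᵃ`):
term by term, the Hodge–Riemann pairing of the `P = (i, t)`-th primitive parts is `(-1)^{i(i-1)/2} τ(L^{n-i-t} ξ_P x ∪ y)`
(`LefschetzStandardB.hodgeRiemannPairing_primitivePart_eq`), and `L^{n-i-t} ξ_P x = *_η (Lʲ L^{n-i-t} ξ_P x) = *_η (Lᵗ ξ_P x)
= *_η (π_P x)`; dead indices (`i + t > n`) contribute `0` on both sides. [cite: VoisinHodgeI2002, §6.3.2 (6.13) and §7.1.2]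
[cite: Andre1996Motifs, §1.1 (pp. 10–11)] -/
theorem cform_eq_cTrace_lefschetzInvolution_signOp_of_ge (hX : IsSmoothProjective n X) (D : KaehlerRationalDatum n X)
    {a' j : ℕ} (hj : a' + j = n) (x y : complexBetti X (a' + 2 * j)) :
    D.cform hX (a' + 2 * j) x y = D.cTrace hX (cupProduct (show a' + (a' + 2 * j) = 2 * n by omega)
      (lefschetzInvolution (D.hLℂ hX) (show a' + 2 * j + a' = 2 * n by omega)
        ((∑ P : {p : ℕ × ℕ // p.1 + 2 * p.2 = a' + 2 * j}, ((-1 : ℂ) ^ (P.1.1 * (P.1.1 - 1) / 2)) •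
          internalProj (isInternal_lefschetzSummand D.Hη n (D.hLℂ hX) (subsingleton_of_lt hX ℂ) (a' + 2 * j)) P)
            x)) y) := by
  classical
  have hL : HasHardLefschetzProperty D.Hη n := D.hLℂ hX
  have hvan := subsingleton_of_lt hX ℂ
  have hba : a' + 2 * j + a' = 2 * n := by omega
  rw [KaehlerRationalDatum.cform, polarizationForm_apply]
  simp only [LinearMap.sum_apply, map_sum, LinearMap.smul_apply, map_smul, smul_eq_mul]
  refine Finset.sum_congr rfl fun P _ ↦ ?_
  have hP := P.2
  rcases le_or_gt (P.1.1 + P.1.2) n with hlive | hdead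
  · -- live index: `*_η (π_P x) = L^{n-i-t} ξ_P x`
    obtain ⟨u, hu⟩ : ∃ u, P.1.1 + P.1.2 + u = n := ⟨n - P.1.1 - P.1.2, by omega⟩
    have hua : P.1.1 + 2 * u = a' := by omega
    have h' : P.1.1 + 2 * (u + j) = a' + 2 * j := by omega
    have hstar : lefschetzInvolution hL hba (internalProj (isInternal_lefschetzSummand D.Hη n hL hvan (a' + 2 * j)) P x) =
        lefschetzPowTo D.Hη u P.1.1 a' hua (primitivePart D.Hη n hL hvan P x) := by
      rw [← lefschetzPowTo_primitivePart' hL hvan P x,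
        lefschetzPowTo_congr_exponent D.Hη (show P.1.2 = u + j by omega) P.2 h',
        ← lefschetzPowTo_lefschetzPowTo D.Hη j hua rfl h', lefschetzPowTo_eq_lefschetzPow,
        lefschetzInvolution_lefschetzPow hL hj hba]
    rw [hstar]
    exact hodgeRiemannPairing_primitivePart_eq hL hvan (D.cTrace hX) (show a' + (a' + 2 * j) = 2 * n by omega) P hu
      hua x y
  · -- dead index: both sides vanish
    rw [primitivePart_of_lt hL hvan P hdead, internalProj_lefschetzSummand_of_lt hL hvan P hdead x]
    simp only [map_zero, LinearMap.zero_apply, mul_zero]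

/-! ## §2 The conjugate adjoint of a motivated operator is motivated, above the middle degree -/

/-- **The conjugate `Q_D`-adjoint of a motivated operator is motivated, degrees `a = a' + 2j ≥ n` (`a' + j = n`)**,
complex orientation family: for a motivated `u ∈ A_motⁿ(X ⊗ X)_ℂ` and any `T'` with
`Q_D(T' x, y) = Q_D(x, conj [u]_* conj y)` on `Hᵃ(X(ℂ); ℂ)`, `T' = [u']_*` for a motivated `u'`. Same composite
`S = s ∘ *₂ ∘ [σ₊ conj u]_* ∘ *₁ ∘ s` as in part 3 (`*₁ : Hᵃ → Hᵃ'` the inverse Lefschetz isomorphism, `*₂ : Hᵃ' → Hᵃ` the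
isomorphism `Lʲ`, `*₁ ∘ *₂ = id`), §1 for the star of `Q_D`, uniqueness by non-degeneracy.
[cite: Andre1996Motifs, Prop. 2.2 (p. 16) and Prop. 1.2 (p. 11)] [cite: Kleiman1968AlgebraicCycles, §1.4 Prop. 1.4.4] -/
theorem cform_adjoint_conj_mem_map_corrAction_of_ge (hX : IsSmoothProjective n X) (D : KaehlerRationalDatum n X)
    {a' j : ℕ} (hj : a' + j = n) {u : complexBetti (X ⊗ X) (2 * n)} (hu : u ∈ motivatedClasses (n + n) (X ⊗ X) n)
    {T' : complexBetti X (a' + 2 * j) →ₗ[ℂ] complexBetti X (a' + 2 * j)}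
    (hT' : ∀ x y, D.cform hX (a' + 2 * j) (T' x) y = D.cform hX (a' + 2 * j) x (conjClass (ComplexPoints X) (a' + 2 * j)
      (corrAction complexOrientationFamily hX hX (rfl : a' + 2 * j + 2 * n = a' + 2 * j + 2 * n) u
        (conjClass (ComplexPoints X) (a' + 2 * j) y)))) :
    T' ∈ (motivatedClasses (n + n) (X ⊗ X) n).map
      (corrAction complexOrientationFamily hX hX (rfl : a' + 2 * j + 2 * n = a' + 2 * j + 2 * n)) := by
  classical
  have hXX : IsSmoothProjective (n + n) (X ⊗ X) := hX.tensor_holds hX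
  have hη : IsPolarizationClass n X D.Hη := Ring2.AbelianAll.isPolarizationClass_Hη hX D
  have hL : HasHardLefschetzProperty D.Hη n := D.hLℂ hX
  have hba : a' + 2 * j + a' = 2 * n := by omega
  have hab : a' + (a' + 2 * j) = 2 * n := by omega
  -- the five motivated operators
  set sOp : complexBetti X (a' + 2 * j) →ₗ[ℂ] complexBetti X (a' + 2 * j) :=
    ∑ P : {p : ℕ × ℕ // p.1 + 2 * p.2 = a' + 2 * j}, ((-1 : ℂ) ^ (P.1.1 * (P.1.1 - 1) / 2)) •
      internalProj (isInternal_lefschetzSummand D.Hη n (D.hLℂ hX) (subsingleton_of_lt hX ℂ) (a' + 2 * j)) P with hsOp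
  set star₁ := lefschetzInvolution hL hba with hstar₁
  set star₂ := lefschetzInvolution hL hab with hstar₂
  set ubar := conjClass (ComplexPoints (X ⊗ X)) (2 * n) u with hubar_def
  set v := complexGysin complexOrientationFamily hXX hXX (β_ X X).hom
    (rfl : 2 * n + 2 * (n + n) = 2 * n + 2 * (n + n)) ubar with hv_def
  set V := corrAction complexOrientationFamily hX hX (rfl : a' + 2 * n = a' + 2 * n) v with hV_def
  set S := sOp ∘ₗ (star₂ ∘ₗ (V ∘ₗ (star₁ ∘ₗ sOp))) with hS_def
  -- memberships
  have hubar : ubar ∈ motivatedClasses (n + n) (X ⊗ X) n := conjClass_mem_motivatedClasses hXX n hu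
  have hv : v ∈ motivatedClasses (n + n) (X ⊗ X) n :=
    complexGysin_braiding_mem_motivatedClasses complexOrientationFamily hX hubar
  have hsMem : sOp ∈ (motivatedClasses (n + n) (X ⊗ X) n).map
      (corrAction complexOrientationFamily hX hX (rfl : a' + 2 * j + 2 * n = a' + 2 * j + 2 * n)) :=
    signOp_mem_map_corrAction complexOrientationFamily hX D (a' + 2 * j)
  have hstar₁Mem : star₁ ∈ (motivatedClasses (n + n) (X ⊗ X) a').map
      (corrAction complexOrientationFamily hX hX (show a' + 2 * j + 2 * a' = a' + 2 * n by omega)) :=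
    lefschetzInvolution_mem_map_corrAction complexOrientationFamily hX hη hba
  have hstar₂Mem : star₂ ∈ (motivatedClasses (n + n) (X ⊗ X) (a' + 2 * j)).map
      (corrAction complexOrientationFamily hX hX (show a' + 2 * (a' + 2 * j) = a' + 2 * j + 2 * n by omega)) :=
    lefschetzInvolution_mem_map_corrAction complexOrientationFamily hX hη hab
  have hVMem : V ∈ (motivatedClasses (n + n) (X ⊗ X) n).map
      (corrAction complexOrientationFamily hX hX (rfl : a' + 2 * n = a' + 2 * n)) :=
    Submodule.mem_map_of_mem hv
  have h1 : star₁ ∘ₗ sOp ∈ (motivatedClasses (n + n) (X ⊗ X) a').map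
      (corrAction complexOrientationFamily hX hX (show a' + 2 * j + 2 * a' = a' + 2 * n by omega)) :=
    comp_mem_map_corrAction_motivatedClasses complexOrientationFamily hX hX hX
      (show a' + n = a' + n from rfl) rfl (by omega) (by omega) hstar₁Mem hsMem
  have h2 : V ∘ₗ (star₁ ∘ₗ sOp) ∈ (motivatedClasses (n + n) (X ⊗ X) a').map
      (corrAction complexOrientationFamily hX hX (show a' + 2 * j + 2 * a' = a' + 2 * n by omega)) :=
    comp_mem_map_corrAction_motivatedClasses complexOrientationFamily hX hX hX
      (show n + a' = a' + n by omega) (by omega) rfl (by omega) hVMem h1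
  have h3 : star₂ ∘ₗ (V ∘ₗ (star₁ ∘ₗ sOp)) ∈ (motivatedClasses (n + n) (X ⊗ X) n).map
      (corrAction complexOrientationFamily hX hX (rfl : a' + 2 * j + 2 * n = a' + 2 * j + 2 * n)) :=
    comp_mem_map_corrAction_motivatedClasses complexOrientationFamily hX hX hX
      (show (a' + 2 * j) + a' = n + n by omega) (by omega) (by omega) rfl hstar₂Mem h2
  have hS : S ∈ (motivatedClasses (n + n) (X ⊗ X) n).map
      (corrAction complexOrientationFamily hX hX (rfl : a' + 2 * j + 2 * n = a' + 2 * j + 2 * n)) :=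
    comp_mem_map_corrAction_motivatedClasses complexOrientationFamily hX hX hX
      (show n + n = n + n from rfl) rfl rfl rfl hsMem h3
  -- `S` is a conjugate adjoint of `[u]_*`
  have hSadj : ∀ x y, D.cform hX (a' + 2 * j) (S x) y = D.cform hX (a' + 2 * j) x
      (conjClass (ComplexPoints X) (a' + 2 * j)
        (corrAction complexOrientationFamily hX hX (rfl : a' + 2 * j + 2 * n = a' + 2 * j + 2 * n) u
          (conjClass (ComplexPoints X) (a' + 2 * j) y))) := by
    intro x y
    rw [conjClass_corrAction hX hX rfl u, conjClass_conjClass, ← hubar_def,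
      cform_eq_cTrace_lefschetzInvolution_signOp_of_ge hX D hj,
      cform_eq_cTrace_lefschetzInvolution_signOp_of_ge hX D hj]
    -- left: `*₁ s S x = V (*₁ s x)`
    have hleft : star₁ (sOp (S x)) = V (star₁ (sOp x)) := by
      simp only [hS_def, LinearMap.comp_apply]
      rw [signOp_signOp hX D (a' + 2 * j), hstar₁, hstar₂, lefschetzInvolution_lefschetzInvolution_of_le hL hj hab hba]
    rw [← hsOp, ← hstar₁, hleft]
    -- right: cup-adjunction, all signs cancel
    set z := star₁ (sOp x) with hz
    rw [cupProduct_gradedComm_holds ℂ (ComplexPoints X) hab hba z,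
      cupProduct_corrAction_braiding complexOrientationFamily hX (rfl : a' + 2 * j + 2 * n = a' + 2 * j + 2 * n) hba
        (rfl : a' + 2 * n = a' + 2 * n) hba ubar y z,
      cupProduct_gradedComm_holds ℂ (ComplexPoints X) hba hab y, ← hv_def, ← hV_def, smul_smul, smul_smul,
      ← pow_add, ← pow_add, Even.neg_one_pow ⟨a' * (a' + 2 * j) + (a' + 2 * j) * a', by ring⟩, one_smul]
  -- uniqueness of the adjoint
  have hTS : T' = S := by
    refine LinearMap.ext fun x ↦ ?_
    rw [← sub_eq_zero]
    refine (cform_nondegenerate hX D (a' + 2 * j)).1 _ fun y ↦ ?_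
    rw [map_sub, LinearMap.sub_apply, hT', hSadj, sub_self]
  rw [hTS]
  exact hS

/-! ## §3 All degrees, all orientation families; André's semisimplicity proof in every degree -/

/-- **ANDRÉ'S POSITIVE INVOLUTION PRESERVES THE MOTIVATED OPERATOR ALGEBRA `R_a`, EVERY DEGREE `a`** (complex
orientation family): for a motivated `u ∈ A_motⁿ(X ⊗ X)_ℂ` and any `T'` with `Q_D(T' x, y) = Q_D(x, conj [u]_* conj y)`
on `Hᵃ(X(ℂ); ℂ)`, `T'` is the operator of a motivated class. Degrees `a ≤ n`: part 3; `n ≤ a ≤ 2n`: §2 with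
`a = (2n − a) + 2(a − n)`; `a > 2n`: `Hᵃ(X(ℂ); ℂ) = 0` and `T' = 0`. With part 2 this makes `(R_a, ')` a POSITIVE
INVOLUTIVE ALGEBRA — André's «forme bilinéaire symétrique … définie positive» on `C⁰_mot(X, X)`, degree by degree,
on the real carriers. [cite: Andre1996Motifs, Prop. 2.2 (p. 16), Prop. 1.2 (p. 11) and Prop. 3.3 (pp. 21–22)] -/
theorem cform_adjoint_conj_mem_map_corrAction (hX : IsSmoothProjective n X) (D : KaehlerRationalDatum n X) (a : ℕ)
    {u : complexBetti (X ⊗ X) (2 * n)} (hu : u ∈ motivatedClasses (n + n) (X ⊗ X) n)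
    {T' : complexBetti X a →ₗ[ℂ] complexBetti X a}
    (hT' : ∀ x y, D.cform hX a (T' x) y = D.cform hX a x (conjClass (ComplexPoints X) a
      (corrAction complexOrientationFamily hX hX (rfl : a + 2 * n = a + 2 * n) u (conjClass (ComplexPoints X) a y)))) :
    T' ∈ (motivatedClasses (n + n) (X ⊗ X) n).map
      (corrAction complexOrientationFamily hX hX (rfl : a + 2 * n = a + 2 * n)) := by
  rcases le_or_gt a n with ha | ha
  · exact cform_adjoint_conj_mem_map_corrAction_of_le hX D ha hu hT'
  rcases le_or_gt a (2 * n) with ha2 | ha2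
  · obtain ⟨a', j, rfl, hj⟩ : ∃ a' j, a = a' + 2 * j ∧ a' + j = n := ⟨2 * n - a, a - n, by omega, by omega⟩
    exact cform_adjoint_conj_mem_map_corrAction_of_ge hX D hj hu hT'
  · -- above the top degree the carrier is zero, so `T' = 0`
    haveI := subsingleton_complexBetti hX ha2
    have hT0 : T' = 0 := LinearMap.ext fun x ↦ Subsingleton.elim _ _
    rw [hT0]
    exact Submodule.zero_mem _

/-- **… for EVERY orientation family `μ`** (the operators `[u]_*^μ` are `c • [u]_*` for one `c ≠ 0`, so the conjugate
adjoint of `[u]_*^μ` is `conj c` times that of `[u]_*`, and the image submodules agree).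
[cite: Andre1996Motifs, Prop. 2.2 (p. 16)] [cite: FultonYoungTableaux1997, Appendix B §B.1 (5)] -/
theorem cform_adjoint_conj_mem_map_corrAction_of_orientationFamily (μ : OrientationFamily)
    (hX : IsSmoothProjective n X) (D : KaehlerRationalDatum n X) (a : ℕ)
    {u : complexBetti (X ⊗ X) (2 * n)} (hu : u ∈ motivatedClasses (n + n) (X ⊗ X) n)
    {T' : complexBetti X a →ₗ[ℂ] complexBetti X a}
    (hT' : ∀ x y, D.cform hX a (T' x) y = D.cform hX a x (conjClass (ComplexPoints X) a
      (corrAction μ hX hX (rfl : a + 2 * n = a + 2 * n) u (conjClass (ComplexPoints X) a y)))) :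
    T' ∈ (motivatedClasses (n + n) (X ⊗ X) n).map (corrAction μ hX hX (rfl : a + 2 * n = a + 2 * n)) := by
  obtain ⟨c, hc, hμ⟩ := corrAction_eq_smul_of_orientationFamily
    (OrientationFamily.hasPoincareDuality complexOrientationFamily) (OrientationFamily.hasPoincareDuality μ) hX hX
    (rfl : a + 2 * n = a + 2 * n)
  have hc' : starRingEnd ℂ c ≠ 0 := (map_ne_zero _).2 hc
  rw [hμ, Submodule.map_smul _ _ _ hc]
  have h := cform_adjoint_conj_mem_map_corrAction hX D a hu (T' := (starRingEnd ℂ c)⁻¹ • T') fun x y ↦ by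
    rw [LinearMap.smul_apply, map_smul, LinearMap.smul_apply, smul_eq_mul, hT' x y, hμ, LinearMap.smul_apply,
      LinearMap.smul_apply, conjClass_smul, map_smul, smul_eq_mul, ← mul_assoc, inv_mul_cancel₀ hc', one_mul]
  have h' := Submodule.smul_mem _ (starRingEnd ℂ c) h
  rwa [smul_smul, mul_inv_cancel₀ hc', one_smul] at h'

/-- **ANDRÉ'S OWN PROOF OF THE SEMISIMPLICITY OF `R_a`, EVERY DEGREE** (any orientation family): `R_a` is Artinian, a
Jacobson-radical element `x = [u]_*` has its conjugate adjoint `x'` in `R_a` (`cform_adjoint_conj_mem_map_corrAction_of_orientationFamily`),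
`x' x` is nilpotent, `Tr(x ∘ x') = Tr(x' ∘ x) = 0`, and `x = 0` by the positivity of part 2. This is the route of
André's text (Prop. 3.3: «résulte aussi du théorème de l'indice de Hodge, cf. [Kl68] 3.11»), beside gen 37's
trace-formula route `isSemisimpleRing_adjoin_motivatedOperators`. [cite: Andre1996Motifs, Prop. 3.3 (pp. 21–22)]
[cite: Kleiman1968AlgebraicCycles, §3, 3.11] [cite: Jannsen1992, Lemma 1–2] -/
theorem isSemisimpleRing_adjoin_motivatedOperators_of_positiveInvolution' (μ : OrientationFamily)
    (hX : IsSmoothProjective n X) (D : KaehlerRationalDatum n X) (a : ℕ) :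
    IsSemisimpleRing (Algebra.adjoin ℂ ((motivatedClasses (n + n) (X ⊗ X) n).map
      (corrAction μ hX hX (rfl : a + 2 * n = a + 2 * n)) : Set (Module.End ℂ (complexBetti X a)))) := by
  set M := (motivatedClasses (n + n) (X ⊗ X) n).map (corrAction μ hX hX (rfl : a + 2 * n = a + 2 * n)) with hM
  set B := Algebra.adjoin ℂ (M : Set (Module.End ℂ (complexBetti X a))) with hB
  have hBM : ∀ x : Module.End ℂ (complexBetti X a), x ∈ B ↔ x ∈ M := fun x ↦ by
    rw [← SetLike.mem_coe, hB, hM, adjoin_motivatedOperators_eq μ hX a, SetLike.mem_coe]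
  haveI : Module.Finite ℂ (complexBetti X a) := finite_complexBetti hX a
  haveI : IsArtinianRing B := IsArtinianRing.of_finite ℂ B
  rw [IsArtinianRing.isSemisimpleRing_iff_jacobson]
  refine eq_bot_iff.mpr fun x hx ↦ ?_
  obtain ⟨k, hk⟩ := IsSemiprimaryRing.isNilpotent (R := B)
  obtain ⟨u, hu, hux⟩ := (hBM x).mp x.2
  obtain ⟨T', hT', -⟩ := exists_unique_cform_adjoint_conj hX D (x : Module.End ℂ (complexBetti X a))
  have hT'u : ∀ z y, D.cform hX a (T' z) y = D.cform hX a z (conjClass (ComplexPoints X) a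
      (corrAction μ hX hX (rfl : a + 2 * n = a + 2 * n) u (conjClass (ComplexPoints X) a y))) := by
    intro z y; rw [hT' z y, ← hux]
  have hT'B : T' ∈ B := (hBM T').2 (cform_adjoint_conj_mem_map_corrAction_of_orientationFamily μ hX D a hu hT'u)
  have hnil : IsNilpotent (T' * (x : Module.End ℂ (complexBetti X a))) := by
    have hmem := Ideal.pow_mem_pow (Ideal.mul_mem_left _ ⟨T', hT'B⟩ hx) k
    rw [hk, Ideal.zero_eq_bot, Ideal.mem_bot] at hmem
    refine ⟨k, ?_⟩
    have h := congrArg Subtype.val hmem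
    simpa only [Subalgebra.coe_pow, Subalgebra.coe_mul, Subalgebra.coe_zero] using h
  have htr : LinearMap.trace ℂ _ (corrAction μ hX hX (rfl : a + 2 * n = a + 2 * n) u ∘ₗ T') = 0 := by
    rw [← Module.End.mul_eq_comp, LinearMap.trace_mul_comm, hux]
    exact (LinearMap.isNilpotent_trace_of_isNilpotent hnil).eq_zero
  obtain ⟨r, -, hr, hr0⟩ := exists_trace_corrAction_comp_eq_of_mem_motivatedClasses μ hX D a hu hT'u
  rw [hr, Complex.ofReal_eq_zero] at htr
  have hx0 : (x : Module.End ℂ (complexBetti X a)) = 0 := by rw [← hux]; exact hr0.1 htr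
  rw [Ideal.mem_bot]
  exact Subtype.ext hx0

end Summit.HodgeConjecture.HodgeConjecture.Theorems

end
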